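import Literature.Probability.RandomPlanarGeometry.CurvePinch
import Mathlib.Algebra.Order.BigOperators.Group.Finset
import Mathlib.Data.Finset.Sort
import HarnessLib

/-!
# Net localization of shell traversals, with thresholds

Topic `Literature/Probability/RandomPlanarGeometry` (companion to `CurvePinch.lean` and
`CurveTortuosity.lean`, whose `Curve.HasTraversals k x r R` — "`D(x; r, R)` is traversed by `k`
separate segments of the curve", Aizenman–Burchard 1999, §1.b (1.3) — is the notion used).
Deterministic plane geometry behind the reduction of an Aizenman–Burchard-type traversal bound
with a threshold `Σ_{j<M} κ j` on one shell `D(x; ρ₁, R₁)` to the thresholds `κ j` on the `M`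
small shells centred at the net points `c_j = x + m e^{i(-π + 2πj/M)}` of the middle circle
`|z - x| = m`, `m = (ρ₁ + R₁)/2`:

* `Curve.exists_net_hasTraversals_of_hasTraversals` — **net localization with thresholds**: if a
  planar curve makes `Σ_{j<M} κ j` separate traversals of `D(x; ρ₁, R₁)`, then for SOME `j < M`
  it makes `κ j` separate traversals of `D(c_j; 2πm/M, (R₁ - ρ₁)/2 - 2πm/M)`.  Each traversal
  passes the middle circle (intermediate value theorem, `Curve.exists_mem_sphere_of_isTraversal`)
  at a point within `2πm/M` of a net point (`exists_dist_circleNet_le`); by the weighted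
  pigeonhole principle some net point `c_j` receives `≥ κ j` passages, and the initial
  sub-segments of the corresponding traversals (start to passage) traverse the small shell
  about `c_j`, on the same pairwise disjoint parameter intervals.

No new definitions.  Folklore (elementary); the net device is the one-dimensional-net variant
of AB99's covering argument (§1.b, Lemma 3.1).  Mathlib anchors: `Finset.card_eq_sum_card_fiberwise`,
`Finset.exists_le_of_sum_le`, `Finset.orderEmbOfCardLe`; tree anchors:
`Curve.exists_mem_sphere_of_isTraversal`, `le_dist_of_endpoint`, `exists_dist_circleNet_le`
(`CurvePinch.lean`).

## References
* M. Aizenman, A. Burchard, *Hölder regularity and dimension bounds for random curves*, Duke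
  Math. J. 99 (1999), §1.b (1.3), Lemma 3.1 [AizenmanBurchardDuke1999].
-/

noncomputable section

open _root_.Set _root_.Metric _root_.Complex _root_.Real
open scoped unitInterval

namespace Literature.Probability.RandomPlanarGeometry

/-- **Net localization with thresholds** (Aizenman–Burchard-type reduction to small shells on
the middle circle): if a planar curve makes `Σ_{j<M} κ j` separate traversals of
`D(x; ρ₁, R₁)`, then for some `j < M` it makes `κ j` separate traversals of the small shell
`D(c_j; 2πm/M, (R₁ - ρ₁)/2 - 2πm/M)` about the net point `c_j = x + m e^{i(-π + 2πj/M)}` of the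
middle circle, `m = (ρ₁ + R₁)/2`. [cite: AizenmanBurchardDuke1999, §1.b] -/
theorem Curve.exists_net_hasTraversals_of_hasTraversals {γ : Curve ℂ} {x : ℂ} {ρ₁ R₁ : ℝ}
    (hρ : 0 ≤ ρ₁) (hR : ρ₁ < R₁) {M : ℕ} (hM : 1 ≤ M) (κ : ℕ → ℕ)
    (h : γ.HasTraversals (∑ j ∈ Finset.range M, κ j) x ρ₁ R₁) :
    ∃ j : ℕ, j < M ∧ γ.HasTraversals (κ j)
      (x + (((ρ₁ + R₁) / 2 : ℝ) : ℂ) *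
        Complex.exp (((-Real.pi + 2 * Real.pi * j / M : ℝ) : ℂ) * Complex.I))
      (2 * Real.pi * ((ρ₁ + R₁) / 2) / M)
      ((R₁ - ρ₁) / 2 - 2 * Real.pi * ((ρ₁ + R₁) / 2) / M) := by
  classical
  have hρr : ρ₁ < (ρ₁ + R₁) / 2 := by linarith
  have hrR : (ρ₁ + R₁) / 2 < R₁ := by linarith
  have hrpos : 0 < (ρ₁ + R₁) / 2 := by linarith
  obtain ⟨s, t, hst, hsep⟩ := h
  -- passage times through the middle sphere
  have hm : ∀ i, ∃ m : I, s i < m ∧ m ≤ t i ∧ dist (γ m) x = (ρ₁ + R₁) / 2 := fun i =>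
    Curve.exists_mem_sphere_of_isTraversal hρr hrR (hst i)
  choose m hsm hmt hmr using hm
  -- nearest net points
  have hnet : ∀ i, ∃ j : ℕ, j < M ∧
      dist (γ (m i)) (x + (((ρ₁ + R₁) / 2 : ℝ) : ℂ) *
        Complex.exp (((-Real.pi + 2 * Real.pi * j / M : ℝ) : ℂ) * Complex.I)) ≤
        2 * Real.pi * ((ρ₁ + R₁) / 2) / M := fun i =>
    exists_dist_circleNet_le hrpos (hmr i) hM
  choose jf hjM hjd using hnet
  -- weighted pigeonhole: some fibre of `jf` has at least `κ j` elements
  have hmaps : ((Finset.univ : Finset (Fin (∑ j ∈ Finset.range M, κ j))) : Set _).MapsTo jf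
      (Finset.range M) :=
    fun i _ => Finset.mem_coe.2 (Finset.mem_range.2 (hjM i))
  have hcard : ∑ j ∈ Finset.range M, κ j =
      ∑ j ∈ Finset.range M, (Finset.univ.filter fun i => jf i = j).card := by
    rw [← Finset.card_eq_sum_card_fiberwise hmaps, Finset.card_univ, Fintype.card_fin]
  obtain ⟨j, hjr, hjle⟩ := Finset.exists_le_of_sum_le
    (Finset.nonempty_range_iff.2 (by omega)) hcard.le
  refine ⟨j, Finset.mem_range.1 hjr, ?_⟩
  -- enumerate `κ j` elements of the fibre increasingly
  obtain ⟨e, he⟩ : ∃ e : Fin (κ j) ↪o Fin (∑ j ∈ Finset.range M, κ j), ∀ l, jf (e l) = j :=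
    ⟨_, fun l => (Finset.mem_filter.1
      ((Finset.univ.filter fun i => jf i = j).orderEmbOfCardLe_mem hjle l)).2⟩
  refine ⟨fun l => s (e l), fun l => m (e l), fun l => ?_, fun l l' hll' => ?_⟩
  · -- the initial sub-segment traverses the small shell (outside → inside)
    have hnear := hjd (e l)
    rw [he l] at hnear
    refine ⟨(hsm (e l)).le, Or.inr ⟨?_, hnear⟩⟩
    have hfar : (R₁ - ρ₁) / 2 ≤ dist (γ (s (e l))) (γ (m (e l))) := by
      rcases (hst (e l)).2 with ⟨hs, -⟩ | ⟨hs, -⟩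
      · exact le_dist_of_endpoint (hmr (e l)) (Or.inl hs)
      · exact le_dist_of_endpoint (hmr (e l)) (Or.inr hs)
    have htri := dist_triangle (γ (s (e l)))
      (x + (((ρ₁ + R₁) / 2 : ℝ) : ℂ) *
        Complex.exp (((-Real.pi + 2 * Real.pi * j / M : ℝ) : ℂ) * Complex.I)) (γ (m (e l)))
    rw [dist_comm (x + _) (γ (m (e l)))] at htri
    linarith
  · -- separation is inherited along the strictly monotone enumeration
    exact lt_of_le_of_lt (hmt (e l)) (hsep (e.strictMono hll'))

end Literature.Probability.RandomPlanarGeometry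

end
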